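import Summits.NavierStokesRegularity.NavierStokesRegularity.Theorems.OddMorawetzOddMorawetzLocalLiveReduction
import Summits.NavierStokesRegularity.NavierStokesRegularity.Theorems.OddMorawetzOddMorawetzLocalKernelEqSpan
import Summits.NavierStokesRegularity.NavierStokesRegularity.Theorems.OddMorawetzOddMorawetzLocalCertBridge
import Summits.NavierStokesRegularity.NavierStokesRegularity.Theorems.OddMorawetzOddMorawetzLocalIsoCert
import Summits.NavierStokesRegularity.NavierStokesRegularity.Theorems.OddMorawetzOddMorawetzLocalIsoTransfer
import Summits.NavierStokesRegularity.NavierStokesRegularity.Theorems.OddMorawetzOddMorawetzLocalCert3A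
import Summits.NavierStokesRegularity.NavierStokesRegularity.Theorems.OddMorawetzOddMorawetzLocalCert3B
import Summits.NavierStokesRegularity.NavierStokesRegularity.Theorems.OddMorawetzOddMorawetzLocalCert3C
import Summits.NavierStokesRegularity.NavierStokesRegularity.Theorems.OddMorawetzOddMorawetzLocalCert3D
import HarnessLib

/-!
# Crux `OddMorawetzLocal` (stmt-NavierStokesRegularity-1376) — weight 3: reduction to the single live density `R`

Instantiation of `live_reduction` with the weight-3 data (`reps3`, `isoDesc3`, `blocks3`, `kcols3`, `cinv3`, prime
8191) and its kernel certificates (`cert3_*`): for an `O(3)`-fixed weight-3 coefficient vector `τ` there is a real `γ`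
with `morawetzPairing 3 v τ = γ · morawetzPairing 3 v R` for every divergence-free Schwartz field `v`, where
`R = isoPolyF isoDesc3[0]` is the live density (the other 16 isotropic basis elements are divergences or ideal members).
Everything is proved; no definitions; no named facts.
-/

noncomputable section

set_option linter.dupNamespace false

namespace Summit.NavierStokesRegularity.NavierStokesRegularity.Theorems.OddMorawetz

open MeasureTheory Literature.Analysis.FluidPDE

/-- `8191` is prime (`2¹³ − 1`). -/
theorem certPrime3_prime : Nat.Prime certPrime3 := by unfold certPrime3; norm_num

/-- Descriptors `1 … 16` of the weight-3 isotropic basis are `null` or `ideal`. -/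
theorem isoDesc3_kind (j : ℕ) (hj : 1 ≤ j) (hj' : j < 17) :
    (∃ sh mt, isoDesc3.getD j (.poly []) = IsoDesc.null sh mt) ∨ (∃ sh mt, isoDesc3.getD j (.poly []) = IsoDesc.ideal sh mt) := by
  have hlen : isoDesc3.length = 17 := cert3_sizes.2.2.1
  have hmem : isoDesc3.getD j (.poly []) ∈ isoDesc3.drop 1 := by
    rw [List.getD_eq_getElem _ _ (by omega)]
    refine List.mem_iff_getElem.2 ⟨j - 1, by simp [hlen]; omega, ?_⟩
    rw [List.getElem_drop]
    congr 1
    omega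
  have h := cert3_iso_kinds
  rw [List.all_eq_true] at h
  have hq := h _ hmem
  revert hq
  cases isoDesc3.getD j (.poly []) with
  | dens sh m => simp
  | null sh m => exact fun _ => Or.inl ⟨sh, m, rfl⟩
  | ideal sh m => exact fun _ => Or.inr ⟨sh, m, rfl⟩
  | poly p => simp

/-- **Weight 3: the pairing of an `O(3)`-fixed coefficient vector is a multiple of the pairing of `R`.** -/
theorem weight_three_live (τ : V 3)
    (hfix : ∀ G ∈ Matrix.unitaryGroup (Fin 3) ℝ, (actMatrix 3 (G : Matrix (Fin 3) (Fin 3) ℝ)).mulVec τ = τ) :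
    ∃ γ : ℝ, ∀ v, IsSchwartzField v → VectorCalculus.IsDivFree v →
      morawetzPairing 3 v τ =
        γ * morawetzPairing 3 v (fun i => ((vecOf 3 (isoPolyF (isoDesc3.getD 0 (.poly []))) i : ℤ) : ℝ)) := by
  haveI : Fact (Nat.Prime certPrime3) := ⟨certPrime3_prime⟩
  obtain ⟨hidx, hreps, hiso, -, -, hrows, -, hkc, hci⟩ := cert3_sizes
  -- representatives are basis monomials
  have hr : ∀ m ∈ reps3, m ∈ idx 3 := by
    have h := cert3_reps_mem
    rw [List.all_eq_true] at h
    exact fun m hm => of_decide_eq_true (h m hm)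
  -- orbit-sum identities from the nine e1Check chunks
  have he := he_of_e1Check_cover 3 reps3 (fun i hi => by
    rw [hidx] at hi
    have h9 : i / 100 < 9 := by omega
    interval_cases h : i / 100
    · exact ⟨0, 100, by omega, by omega, cert3_e1_0⟩
    · exact ⟨100, 100, by omega, by omega, cert3_e1_1⟩
    · exact ⟨200, 100, by omega, by omega, cert3_e1_2⟩
    · exact ⟨300, 100, by omega, by omega, cert3_e1_3⟩
    · exact ⟨400, 100, by omega, by omega, cert3_e1_4⟩
    · exact ⟨500, 100, by omega, by omega, cert3_e1_5⟩
    · exact ⟨600, 100, by omega, by omega, cert3_e1_6⟩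
    · exact ⟨700, 100, by omega, by omega, cert3_e1_7⟩
    · exact ⟨800, 31, by omega, by omega, cert3_e1_8⟩)
  -- derivation kills / reconstruction of the isotropic basis (two chunks each)
  have hsplit : ∀ q ∈ isoDesc3, q ∈ isoDesc3.take 8 ∨ q ∈ isoDesc3.drop 8 := fun q hq => by
    rw [← List.take_append_drop 8 isoDesc3, List.mem_append] at hq
    exact hq
  have hder : ∀ q ∈ isoDesc3, derKillsF lieZ (isoPolyF q) = true := by
    intro q hq
    rcases hsplit q hq with h | h
    · have h0 := cert3_iso_der_0; rw [List.all_eq_true] at h0; exact h0 q h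
    · have h1 := cert3_iso_der_1; rw [List.all_eq_true] at h1; exact h1 q h
  have hrec : ∀ q ∈ isoDesc3, orbitReconF reps3 (isoPolyF q) = true := by
    intro q hq
    rcases hsplit q hq with h | h
    · have h0 := cert3_iso_recon_0; rw [List.all_eq_true] at h0; exact h0 q h
    · have h1 := cert3_iso_recon_1; rw [List.all_eq_true] at h1; exact h1 q h
  -- the certified kernel of the derivation system
  have hI : 0 < (idx 3).length := by rw [hidx]; norm_num
  have hJ : 0 < reps3.length := by rw [hreps]; norm_num
  have hblk : ∀ β, β < blocks3.length →
      blockCheck 3 lieZ reps3 (blocks3.getD β ([], [], [])).1 (blocks3.getD β ([], [], [])).2.1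
        (blocks3.getD β ([], [], [])).2.2 certPrime3 = true := by
    intro β hβ
    rw [cert3_ranges.2] at hβ
    interval_cases β
    · exact cert3_block_0
    · exact cert3_block_1
    · exact cert3_block_2
  have hB := certB_mul_eq_one 3 reps3 blocks3 kcols3 cinv3 17 certPrime3 23 hblk cert3_disjoint cert3_shape.1
    cert3_ranges.1 hrows hI hJ
  have hS := (iso_transfer 3 reps3 isoDesc3 17 hiso hder hrec).1
  have hC := isoCert_mul_eq_one 3 reps3 blocks3 isoDesc3 kcols3 cinv3 17 certPrime3 cert3_iso_cert cert3_ranges.1 hiso hJ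
  have hcard : 23 + 17 = Fintype.card (Fin reps3.length) := by rw [Fintype.card_fin, hreps]
  have hker := kernel_eq_span_of_modular_certificate certPrime3 (aMatrix 3 reps3)
    (certIdx (certRows blocks3) (idx 3).length 23 hI) (certIdx (certCols blocks3) reps3.length 23 hJ)
    (certBd blocks3 certPrime3 23) hB (sVecD reps3 isoDesc3 17) hS (certIdx kcols3 reps3.length 17 hJ)
    (certCd cinv3 certPrime3 17) hC hcard
  -- descriptor facts
  have hcan : ∀ q ∈ isoDesc3, ∀ t ∈ isoPolyF q, t.2 ∈ idx 3 := by
    have h := cert3_iso_canonical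
    rw [List.all_eq_true] at h
    exact fun q hq => mem_idx_of_canonical_check 3 (isoPolyF q) (h q hq)
  have hflux : ∀ sh mt, IsoDesc.null sh mt ∈ isoDesc3 →
      ∀ F ∈ [isoFlux sh mt 0, isoFlux sh mt 1, isoFlux sh mt 2], ∀ t ∈ F, ∀ u ∈ t.2, u.2.length ≤ 3 := by
    intro sh mt hq F hF t ht u hu
    have h := cert3_iso_fluxord
    rw [List.all_eq_true] at h
    have h1 := h _ hq
    simp only [List.all_eq_true, decide_eq_true_eq] at h1
    exact h1 F hF t ht u hu
  have hideal : ∀ sh mt, IsoDesc.ideal sh mt ∈ isoDesc3 → nfKillsF (isoPolyF (.ideal sh mt)) = true := by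
    intro sh mt hq
    have h := cert3_iso_ideal
    rw [List.all_eq_true] at h
    exact h _ hq
  obtain ⟨γ, hγ⟩ := live_reduction 3 τ hfix reps3 hr he isoDesc3 17 hiso hrec hker 1
    (fun j hj hj' => isoDesc3_kind j hj hj') hcan hflux hideal
  refine ⟨γ 0, fun v hv hdv => ?_⟩
  rw [hγ v hv hdv, Fin.sum_univ_succ]
  simp only [Fin.val_zero, Nat.lt_one_iff, if_true, Fin.val_succ, Nat.add_one_ne_zero, if_false,
    Finset.sum_const_zero, add_zero]

end Summit.NavierStokesRegularity.NavierStokesRegularity.Theorems.OddMorawetz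

end
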